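import Summits.CriticalPhenomena.PercolationContinuityZ3.Theorems.PercNearOneGluingNoHeavyPcintLoopExclusionRungFourCounts
import Summits.CriticalPhenomena.PercolationContinuityZ3.Theorems.PercNearOneGluingNoHeavyPcintMemoryFourBrackets
import HarnessLib

/-!
# CriticalPhenomena/PercolationContinuityZ3 — Theorems/PercNearOneGluingNoHeavyPcintLoopExclusionRungFourDimension.lean: the DIMENSION LAW of the first rung of C4 — `R_4(d) ↑ 1` strictly in `d`, with `1 − R_4(d) ~ 1/d` (`(2d−1)(1 − R_4(d)) → 2`); clause (b) `loopCompatStrictMonoDim` of the typed law is a THEOREM at `τ = 4`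

Lane prim-pcint, STRUCTURE rule (NUMERICS ⇒ STRUCTURE ⇒ CONJECTURE).  The typed law C4 (…PcintLoopExclusionLaw) says of the
loop-exclusion compatibility factor `R_τ(d) = Δ_τ(d)/f_τ(d)`: (a) `0 < R < 1` (the first rung `τ = 4` proved by gen 16), (b)
`R_τ(d) < R_τ(d+1)` ("loops and arms become mutually transparent as `d` grows; `R → 1⁻` would be the mean-field reading"),
(c), (d) … .  Here (b) AND the mean-field reading are settled at the first rung, for every dimension, in closed form:

* **two-sided rational bounds** `loopCompat_four_ge_rat` / `loopCompat_four_le_rat`: with `x = 2d − 1`,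
  `B(x) ≤ R_4(d) ≤ A(x)`, `A = x⁴/(x²−1)·(t + t²)`, `t = 1/x² − 2/x³ + 3/x⁴`, `B = x⁴/(x²−1)·(u + u²/2)`, `u = t − 8/x⁵`
  (closed form `R_4 = x⁴/(x²−1)·ln(x/μ_4)` of …RungFourCounts, the `1/x`-brackets of the Fisher–Sykes root and the
  logarithmic series of …MemoryFourBrackets);
* **the defect law** `loopCompat_four_defect_ge` / `_lt`: **`2 − 5/(2d−1) ≤ (2d−1)(1 − R_4(d)) < 2` for every `d ≥ 2`**, so
  `R_4(d) > (2d−3)/(2d−1)`, **`R_4(d) → 1`** (`tendsto_loopCompat_four`), **`(2d−1)(1 − R_4(d)) → 2`**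
  (`tendsto_loopCompat_four_defect`) and **`d·(1 − R_4(d)) → 1`** (`tendsto_mul_one_sub_loopCompat_four`): at the first rung the
  compatibility defect IS `1/d` to leading order (`1 − R_4 = 2/x − 9/(2x²) + O(x⁻³)`) — the mean-field reading, IDENTIFIED;
* **clause (b) at the first rung**: `loopCompat_four_lt_succ` — **`R_4(d) < R_4(d+1)` for every `d ≥ 2`** (`d ≥ 3`: `A(x) < B(x+2)`
  is the polynomial certificate `chainPoly_pos`; `d = 2`: decimal brackets), hence `loopCompat_four_lt_of_lt` (strictly increasing
  on `d ≥ 2`) and **`loopCompatStrictMonoDim_rung_four`**, the `m = 2` instance of the typed conjecture `loopCompatStrictMonoDim`.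

Values: R_4(d) = 0.5864, 0.7153, 0.7802, 0.8204, 0.8480, 0.8682, 0.8836 (d = 2..8; the first five are the lane's measured factors,
STRUCTURE.md §1); (2d−1)(1−R_4) = 1.24, 1.42, 1.54, 1.62, 1.67, …, 1.978 (d = 100), 1.9978 (d = 1000).
All polynomial certificates are positive on their half-line because every Taylor coefficient at its left end is (numerics/certs.py
of the seat folder reproduces them).  HONEST FRAMING: elementary real analysis on closed forms; nothing here is used by a certified
`p_c` cell.  Written by prim-pcint-2 gen 17 (prover-prim-pcint-2-g17-0), 2026-08-25.
-/

noncomputable section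

open Filter Topology
open Literature.Probability.LatticeModels Literature.Probability.Percolation
open Summit.CriticalPhenomena.PercolationContinuityZ3.Theorems.Pcint

namespace Summit.CriticalPhenomena.PercolationContinuityZ3.Theorems.Pcint.MemoryTail

variable {d : ℕ}

/-! ### Two-sided rational bounds for `R_4(d)` -/

/-- The prefactor `(2d−1)⁴/(2d(2d−2)) = x⁴/(x²−1)`, `x = 2d − 1`. [folklore] -/
theorem rungFour_prefactor_eq (d : ℕ) {x : ℝ} (hx : x = 2 * d - 1) :
    (2 * (d : ℝ) - 1) ^ 4 / (2 * d * (2 * d - 2)) = x ^ 4 / (x ^ 2 - 1) := by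
  rw [hx, show (2 * (d : ℝ) - 1) ^ 2 - 1 = 2 * d * (2 * d - 2) by ring]

/-- **Upper bound `R_4(d) ≤ A(x) = x⁴/(x²−1)·(t + t²)`, `t = 1/x² − 2/x³ + 3/x⁴`, `x = 2d − 1`** (as one rational function), every
`d ≥ 2`: `μ_4 ≥ x − 1/x + 2/x² − 3/x³` and `ln(x/θ) ≤ t + t²` with `t = (x−θ)/x ≤ 1/4`. [folklore] -/
theorem loopCompat_four_le_rat (hd : 2 ≤ d) {x : ℝ} (hx : x = 2 * d - 1) :
    loopCompat d 4 ≤ (9 - 12 * x + 10 * x ^ 2 - 4 * x ^ 3 + 4 * x ^ 4 - 2 * x ^ 5 + x ^ 6) / (x ^ 4 * (x ^ 2 - 1)) := by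
  haveI : NeZero d := ⟨by omega⟩
  have hd' : (2 : ℝ) ≤ d := by exact_mod_cast hd
  have hx3 : 3 ≤ x := by rw [hx]; linarith
  have hx0 : 0 < x := by linarith
  have hx21 : 0 < x ^ 2 - 1 := by nlinarith
  have hμ := memGrowth_four_ge_series hd hx
  have hμpos : 0 < memGrowth d 4 := memGrowth_pos 4
  set θ : ℝ := x - 1 / x + 2 / x ^ 2 - 3 / x ^ 3 with hθdef
  have hθ : θ = (x ^ 4 - x ^ 2 + 2 * x - 3) / x ^ 3 := by rw [hθdef]; field_simp
  have hθpos : 0 < θ := by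
    rw [hθ]; exact div_pos (by nlinarith [pow_pos hx0 2, mul_le_mul_of_nonneg_left hx3 (pow_pos hx0 3).le]) (pow_pos hx0 3)
  have hθx : θ ≤ x := by
    rw [hθ, div_le_iff₀ (pow_pos hx0 3)]; nlinarith
  have h43 : 3 * x ≤ 4 * θ := by
    rw [hθ, mul_div_assoc', le_div_iff₀ (pow_pos hx0 3)]
    nlinarith [pow_pos hx0 2, mul_le_mul_of_nonneg_left hx3 (pow_pos hx0 3).le, mul_le_mul_of_nonneg_left hx3 (pow_pos hx0 2).le]
  have hlog : Real.log (x / memGrowth d 4) ≤ (x - θ) / x + ((x - θ) / x) ^ 2 :=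
    (Real.log_le_log (div_pos hx0 hμpos) (div_le_div_of_nonneg_left hx0.le hθpos hμ)).trans
      (log_div_le_quad hθpos hθx h43)
  have ht : (x - θ) / x = 1 / x ^ 2 - 2 / x ^ 3 + 3 / x ^ 4 := by rw [hθdef]; field_simp; ring
  rw [loopCompat_four_eq hd, rungFour_prefactor_eq d hx, ← hx]
  calc x ^ 4 / (x ^ 2 - 1) * Real.log (x / memGrowth d 4)
      ≤ x ^ 4 / (x ^ 2 - 1) * ((x - θ) / x + ((x - θ) / x) ^ 2) :=
        mul_le_mul_of_nonneg_left hlog (div_pos (pow_pos hx0 4) hx21).le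
    _ = (9 - 12 * x + 10 * x ^ 2 - 4 * x ^ 3 + 4 * x ^ 4 - 2 * x ^ 5 + x ^ 6) / (x ^ 4 * (x ^ 2 - 1)) := by
        rw [ht]; field_simp; ring

/-- **Lower bound `R_4(d) ≥ B(x) = x⁴/(x²−1)·(u + u²/2)`, `u = 1/x² − 2/x³ + 3/x⁴ − 8/x⁵`, `x = 2d − 1`** (as one rational
function), every `d ≥ 2`: `μ_4 ≤ x − 1/x + 2/x² − 3/x³ + 8/x⁴` and `ln(x/θ) ≥ u + u²/2`. [folklore] -/
theorem loopCompat_four_ge_rat (hd : 2 ≤ d) {x : ℝ} (hx : x = 2 * d - 1) :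
    (64 - 48 * x + 41 * x ^ 2 - 28 * x ^ 3 + 10 * x ^ 4 - 20 * x ^ 5 + 7 * x ^ 6 - 4 * x ^ 7 + 2 * x ^ 8) / (2 * x ^ 6 * (x ^ 2 - 1)) ≤ loopCompat d 4 := by
  haveI : NeZero d := ⟨by omega⟩
  have hd' : (2 : ℝ) ≤ d := by exact_mod_cast hd
  have hx3 : 3 ≤ x := by rw [hx]; linarith
  have hx0 : 0 < x := by linarith
  have hx21 : 0 < x ^ 2 - 1 := by nlinarith
  have hμ := memGrowth_four_le_series hd hx
  have hμpos : 0 < memGrowth d 4 := memGrowth_pos 4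
  set θ : ℝ := x - 1 / x + 2 / x ^ 2 - 3 / x ^ 3 + 8 / x ^ 4 with hθdef
  have hθ : θ = (x ^ 5 - x ^ 3 + 2 * x ^ 2 - 3 * x + 8) / x ^ 4 := by rw [hθdef]; field_simp
  have hθpos : 0 < θ := lt_of_lt_of_le hμpos hμ
  have hθx : θ ≤ x := by
    rw [hθ, div_le_iff₀ (pow_pos hx0 4)]
    nlinarith [pow_pos hx0 2, mul_le_mul_of_nonneg_left hx3 (pow_pos hx0 2).le]
  have hlog : (x - θ) / x + ((x - θ) / x) ^ 2 / 2 ≤ Real.log (x / memGrowth d 4) := by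
    have h1 := series_three_le_log_div hθpos hθx
    have h2 : Real.log (x / θ) ≤ Real.log (x / memGrowth d 4) :=
      Real.log_le_log (div_pos hx0 hθpos) (div_le_div_of_nonneg_left hx0.le hμpos hμ)
    have h3 : 0 ≤ ((x - θ) / x) ^ 3 / 3 := by
      have : 0 ≤ (x - θ) / x := div_nonneg (by linarith) hx0.le
      positivity
    linarith
  have hu : (x - θ) / x = 1 / x ^ 2 - 2 / x ^ 3 + 3 / x ^ 4 - 8 / x ^ 5 := by rw [hθdef]; field_simp; ring
  rw [loopCompat_four_eq hd, rungFour_prefactor_eq d hx, ← hx]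
  calc (64 - 48 * x + 41 * x ^ 2 - 28 * x ^ 3 + 10 * x ^ 4 - 20 * x ^ 5 + 7 * x ^ 6 - 4 * x ^ 7 + 2 * x ^ 8) / (2 * x ^ 6 * (x ^ 2 - 1))
      = x ^ 4 / (x ^ 2 - 1) * ((x - θ) / x + ((x - θ) / x) ^ 2 / 2) := by
        rw [hu]; field_simp; ring
    _ ≤ x ^ 4 / (x ^ 2 - 1) * Real.log (x / memGrowth d 4) :=
        mul_le_mul_of_nonneg_left hlog (div_pos (pow_pos hx0 4) hx21).le

/-! ### The defect law `(2d−1)(1 − R_4(d)) → 2` -/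

/-- Certificate: `6x⁵ − 15x⁴ + 12x³ − 9x² > 0` for `x ≥ 3`. [folklore] -/
theorem defectPolyLo_pos {x : ℝ} (hx : 3 ≤ x) : 0 < -9 * x ^ 2 + 12 * x ^ 3 - 15 * x ^ 4 + 6 * x ^ 5 := by
  obtain ⟨s, hs, rfl⟩ : ∃ s : ℝ, 0 ≤ s ∧ x = s + 3 := ⟨x - 3, by linarith, by ring⟩
  have e : -9 * (s + 3) ^ 2 + 12 * (s + 3) ^ 3 - 15 * (s + 3) ^ 4 + 6 * (s + 3) ^ 5
      = 486 + 1080 * s + 909 * s ^ 2 + 372 * s ^ 3 + 75 * s ^ 4 + 6 * s ^ 5 := by ring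
  rw [e]; positivity

/-- Certificate: `9x⁷ − 24x⁶ + 10x⁵ − 28x⁴ + 41x³ − 48x² + 64x > 0` for `x ≥ 3`. [folklore] -/
theorem defectPolyHi_pos {x : ℝ} (hx : 3 ≤ x) : 0 < 64 * x - 48 * x ^ 2 + 41 * x ^ 3 - 28 * x ^ 4 + 10 * x ^ 5 - 24 * x ^ 6 + 9 * x ^ 7 := by
  obtain ⟨s, hs, rfl⟩ : ∃ s : ℝ, 0 ≤ s ∧ x = s + 3 := ⟨x - 3, by linarith, by ring⟩
  have e : 64 * (s + 3) - 48 * (s + 3) ^ 2 + 41 * (s + 3) ^ 3 - 28 * (s + 3) ^ 4 + 10 * (s + 3) ^ 5 - 24 * (s + 3) ^ 6 + 9 * (s + 3) ^ 7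
      = 3216 + 12844 * s + 18276 * s ^ 2 + 13160 * s ^ 3 + 5387 * s ^ 4 + 1279 * s ^ 5 + 165 * s ^ 6 + 9 * s ^ 7 := by ring
  rw [e]; positivity

/-- **`(2d−1)(1 − R_4(d)) ≥ 2 − 5/(2d−1)`** for every `d ≥ 2` (from the upper bound `A`). [folklore] -/
theorem loopCompat_four_defect_ge (hd : 2 ≤ d) :
    2 - 5 / (2 * (d : ℝ) - 1) ≤ (2 * (d : ℝ) - 1) * (1 - loopCompat d 4) := by
  have hd' : (2 : ℝ) ≤ d := by exact_mod_cast hd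
  set x : ℝ := 2 * d - 1 with hx
  have hx3 : 3 ≤ x := by rw [hx]; linarith
  have hx0 : 0 < x := by linarith
  have hx21 : 0 < x ^ 2 - 1 := by nlinarith
  have hA := loopCompat_four_le_rat hd hx
  have h1 : x * (1 - (9 - 12 * x + 10 * x ^ 2 - 4 * x ^ 3 + 4 * x ^ 4 - 2 * x ^ 5 + x ^ 6) / (x ^ 4 * (x ^ 2 - 1))) ≤ x * (1 - loopCompat d 4) :=
    mul_le_mul_of_nonneg_left (by linarith) hx0.le
  have key : x * (1 - (9 - 12 * x + 10 * x ^ 2 - 4 * x ^ 3 + 4 * x ^ 4 - 2 * x ^ 5 + x ^ 6) / (x ^ 4 * (x ^ 2 - 1))) - (2 - 5 / x)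
      = (-9 * x ^ 2 + 12 * x ^ 3 - 15 * x ^ 4 + 6 * x ^ 5) / (x ^ 5 * (x ^ 2 - 1)) := by
    field_simp
    ring
  have h2 : 0 ≤ (-9 * x ^ 2 + 12 * x ^ 3 - 15 * x ^ 4 + 6 * x ^ 5) / (x ^ 5 * (x ^ 2 - 1)) :=
    div_nonneg (defectPolyLo_pos hx3).le (mul_pos (pow_pos hx0 5) hx21).le
  linarith

/-- **`(2d−1)(1 − R_4(d)) < 2`**, i.e. **`R_4(d) > (2d−3)/(2d−1)`**, for every `d ≥ 2` (from the lower bound `B`). [folklore] -/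
theorem loopCompat_four_defect_lt (hd : 2 ≤ d) : (2 * (d : ℝ) - 1) * (1 - loopCompat d 4) < 2 := by
  have hd' : (2 : ℝ) ≤ d := by exact_mod_cast hd
  set x : ℝ := 2 * d - 1 with hx
  have hx3 : 3 ≤ x := by rw [hx]; linarith
  have hx0 : 0 < x := by linarith
  have hx21 : 0 < x ^ 2 - 1 := by nlinarith
  have hB := loopCompat_four_ge_rat hd hx
  have h1 : x * (1 - loopCompat d 4) ≤ x * (1 - (64 - 48 * x + 41 * x ^ 2 - 28 * x ^ 3 + 10 * x ^ 4 - 20 * x ^ 5 + 7 * x ^ 6 - 4 * x ^ 7 + 2 * x ^ 8) / (2 * x ^ 6 * (x ^ 2 - 1))) :=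
    mul_le_mul_of_nonneg_left (by linarith) hx0.le
  have key : 2 - x * (1 - (64 - 48 * x + 41 * x ^ 2 - 28 * x ^ 3 + 10 * x ^ 4 - 20 * x ^ 5 + 7 * x ^ 6 - 4 * x ^ 7 + 2 * x ^ 8) / (2 * x ^ 6 * (x ^ 2 - 1)))
      = (64 * x - 48 * x ^ 2 + 41 * x ^ 3 - 28 * x ^ 4 + 10 * x ^ 5 - 24 * x ^ 6 + 9 * x ^ 7) / (2 * x ^ 6 * (x ^ 2 - 1)) := by
    field_simp
    ring
  have h2 : 0 < (64 * x - 48 * x ^ 2 + 41 * x ^ 3 - 28 * x ^ 4 + 10 * x ^ 5 - 24 * x ^ 6 + 9 * x ^ 7) / (2 * x ^ 6 * (x ^ 2 - 1)) :=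
    div_pos (defectPolyHi_pos hx3) (mul_pos (mul_pos two_pos (pow_pos hx0 6)) hx21)
  linarith

/-- **`R_4(d) > (2d−3)/(2d−1)`** for every `d ≥ 2`. [folklore] -/
theorem loopCompat_four_gt (hd : 2 ≤ d) : (2 * (d : ℝ) - 3) / (2 * d - 1) < loopCompat d 4 := by
  have hd' : (2 : ℝ) ≤ d := by exact_mod_cast hd
  have hx0 : (0 : ℝ) < 2 * d - 1 := by linarith
  have h := loopCompat_four_defect_lt hd
  rw [div_lt_iff₀ hx0]
  nlinarith

/-- `2d − 1 → ∞` along the naturals. [folklore] -/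
theorem tendsto_two_mul_sub_one : Tendsto (fun d : ℕ => 2 * (d : ℝ) - 1) atTop atTop := by
  have h := tendsto_atTop_add_const_right atTop (-1 : ℝ)
    ((tendsto_natCast_atTop_atTop (R := ℝ)).const_mul_atTop (by norm_num : (0 : ℝ) < 2))
  exact h.congr fun d => by ring

/-- **`(2d−1)(1 − R_4(d)) → 2`**: the first-rung compatibility defect is `2/(2d−1) + O(d⁻²)`. [folklore] -/
theorem tendsto_loopCompat_four_defect :
    Tendsto (fun d : ℕ => (2 * (d : ℝ) - 1) * (1 - loopCompat d 4)) atTop (𝓝 2) := by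
  have hlow : Tendsto (fun d : ℕ => (2 : ℝ) - 5 / (2 * (d : ℝ) - 1)) atTop (𝓝 2) := by
    have h := (tendsto_const_nhds (x := (5 : ℝ))).div_atTop tendsto_two_mul_sub_one
    simpa using (tendsto_const_nhds (x := (2 : ℝ))).sub h
  refine tendsto_of_tendsto_of_tendsto_of_le_of_le' hlow tendsto_const_nhds ?_ ?_
  · filter_upwards [eventually_ge_atTop 2] with d hd using loopCompat_four_defect_ge hd
  · filter_upwards [eventually_ge_atTop 2] with d hd using (loopCompat_four_defect_lt hd).le

/-- **`R_4(d) → 1` as `d → ∞`** (the mean-field reading of clause (b) at the first rung). [folklore] -/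
theorem tendsto_loopCompat_four : Tendsto (fun d : ℕ => loopCompat d 4) atTop (𝓝 1) := by
  have h0 := tendsto_loopCompat_four_defect.div_atTop tendsto_two_mul_sub_one
  have h1 := (tendsto_const_nhds (x := (1 : ℝ))).sub h0
  rw [sub_zero] at h1
  refine h1.congr' ?_
  filter_upwards [eventually_ge_atTop 1] with d hd
  have hx : (2 * (d : ℝ) - 1) ≠ 0 := by
    have : (1 : ℝ) ≤ d := by exact_mod_cast hd
    linarith
  rw [mul_div_cancel_left₀ _ hx]
  ring

/-- **`d·(1 − R_4(d)) → 1`**: `1 − R_4(d) ~ 1/d`. [folklore] -/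
theorem tendsto_mul_one_sub_loopCompat_four :
    Tendsto (fun d : ℕ => (d : ℝ) * (1 - loopCompat d 4)) atTop (𝓝 1) := by
  -- d/(2d−1) → 1/2
  have hhalf : Tendsto (fun d : ℕ => (d : ℝ) / (2 * d - 1)) atTop (𝓝 (1 / 2)) := by
    have h1 : Tendsto (fun d : ℕ => (2 : ℝ) - 1 / (d : ℝ)) atTop (𝓝 (2 - 0)) :=
      tendsto_const_nhds.sub tendsto_one_div_atTop_nhds_zero_nat
    rw [sub_zero] at h1
    have h2 := h1.inv₀ (by norm_num : (2 : ℝ) ≠ 0)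
    rw [show (2 : ℝ)⁻¹ = 1 / 2 by norm_num] at h2
    refine h2.congr' ?_
    filter_upwards [eventually_ge_atTop 1] with d hd
    have hd1 : (1 : ℝ) ≤ d := by exact_mod_cast hd
    have : (d : ℝ) ≠ 0 := by linarith
    have : (2 * (d : ℝ) - 1) ≠ 0 := by linarith
    field_simp
  have h := hhalf.mul tendsto_loopCompat_four_defect
  rw [show (1 / 2 : ℝ) * 2 = 1 by norm_num] at h
  refine h.congr' ?_
  filter_upwards [eventually_ge_atTop 1] with d hd
  have hd1 : (1 : ℝ) ≤ d := by exact_mod_cast hd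
  have hne : (2 * (d : ℝ) - 1) ≠ 0 := by linarith
  calc (d : ℝ) / (2 * d - 1) * ((2 * (d : ℝ) - 1) * (1 - loopCompat d 4))
      = (d : ℝ) * (1 - loopCompat d 4) * ((2 * (d : ℝ) - 1) / (2 * d - 1)) := by ring
    _ = (d : ℝ) * (1 - loopCompat d 4) := by rw [div_self hne, mul_one]

/-! ### Clause (b) at the first rung: `R_4(d) < R_4(d+1)` -/

/-- Certificate of the chain `A(x) < B(x+2)` for `x ≥ 5`: the degree-12 polynomial
`B_num(x+2)·A_den(x) − A_num(x)·B_den(x+2) > 0`. [folklore] -/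
theorem chainPoly_pos {x : ℝ} (hx : 5 ≤ x) : 0 < -3456 - 10368 * x - 11808 * x ^ 2 - 7232 * x ^ 3 - 5708 * x ^ 4 - 8620 * x ^ 5 - 10363 * x ^ 6 - 7992 * x ^ 7 - 3683 * x ^ 8 - 828 * x ^ 9 + 19 * x ^ 10 + 48 * x ^ 11 + 7 * x ^ 12 := by
  obtain ⟨s, hs, rfl⟩ : ∃ s : ℝ, 0 ≤ s ∧ x = s + 5 := ⟨x - 5, by linarith, by ring⟩
  have e : -3456 - 10368 * (s + 5) - 11808 * (s + 5) ^ 2 - 7232 * (s + 5) ^ 3 - 5708 * (s + 5) ^ 4 - 8620 * (s + 5) ^ 5 - 10363 * (s + 5) ^ 6 - 7992 * (s + 5) ^ 7 - 3683 * (s + 5) ^ 8 - 828 * (s + 5) ^ 9 + 19 * (s + 5) ^ 10 + 48 * (s + 5) ^ 11 + 7 * (s + 5) ^ 12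
      = 364365504 + 3317200152 * s + 5428511012 * s ^ 2 + 4345403608 * s ^ 3 + 2127130792 * s ^ 4 + 699086190 * s ^ 5 + 161294067 * s ^ 6 + 26609488 * s ^ 7 + 3136057 * s ^ 8 + 258622 * s ^ 9 + 14209 * s ^ 10 + 468 * s ^ 11 + 7 * s ^ 12 := by ring
  rw [e]; positivity

/-- **`R_4(2) < R_4(3)`** (`0.5864 < 0.7153`): `μ_4(2) ≥ 2.8311` gives `R_4(2) ≤ (81/8)(t + t²)`, `t = 0.1689/3`, which is below
the lower bound `B(5)` of `R_4(3)`. [folklore] -/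
theorem loopCompat_four_two_lt_three : loopCompat 2 4 < loopCompat 3 4 := by
  have hμ : (2.8311 : ℝ) ≤ memGrowth 2 4 :=
    le_memGrowth_four_of_cubic_nonpos (d := 2) le_rfl (by norm_num) (by norm_num)
  haveI : NeZero (2 : ℕ) := ⟨by norm_num⟩
  have hμpos : 0 < memGrowth 2 4 := memGrowth_pos 4
  have hlog : Real.log (3 / memGrowth 2 4) ≤ (3 - 2.8311) / 3 + ((3 - 2.8311) / 3) ^ 2 :=
    (Real.log_le_log (div_pos three_pos hμpos) (div_le_div_of_nonneg_left (by norm_num) (by norm_num) hμ)).trans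
      (log_div_le_quad (x := 3) (θ := 2.8311) (by norm_num) (by norm_num) (by norm_num))
  have h2 : loopCompat 2 4 ≤ 81 / 8 * ((3 - 2.8311) / 3 + ((3 - 2.8311) / 3) ^ 2) := by
    have h := loopCompat_four_eq (d := 2) le_rfl
    norm_num at h
    rw [h]
    linarith
  have h3 := loopCompat_four_ge_rat (d := 3) (by norm_num) (x := 5) (by norm_num)
  have hnum : (81 : ℝ) / 8 * ((3 - 2.8311) / 3 + ((3 - 2.8311) / 3) ^ 2)
      < (64 - 48 * ((5 : ℝ)) + 41 * ((5 : ℝ)) ^ 2 - 28 * ((5 : ℝ)) ^ 3 + 10 * ((5 : ℝ)) ^ 4 - 20 * ((5 : ℝ)) ^ 5 + 7 * ((5 : ℝ)) ^ 6 - 4 * ((5 : ℝ)) ^ 7 + 2 * ((5 : ℝ)) ^ 8) / (2 * (5 : ℝ) ^ 6 * ((5 : ℝ) ^ 2 - 1)) := by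
    norm_num
  linarith

/-- **Clause (b) of C4 at the first rung: `R_4(d) < R_4(d+1)` for every `d ≥ 2`.** [folklore] -/
theorem loopCompat_four_lt_succ (hd : 2 ≤ d) : loopCompat d 4 < loopCompat (d + 1) 4 := by
  rcases (show d = 2 ∨ 3 ≤ d by omega) with rfl | hd3
  · exact loopCompat_four_two_lt_three
  have hd' : (3 : ℝ) ≤ d := by exact_mod_cast hd3
  set x : ℝ := 2 * d - 1 with hx
  have hx5 : 5 ≤ x := by rw [hx]; linarith
  have hx0 : 0 < x := by linarith
  have hx21 : 0 < x ^ 2 - 1 := by nlinarith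
  have hA := loopCompat_four_le_rat hd hx
  have hB := loopCompat_four_ge_rat (d := d + 1) (by omega) (x := x + 2) (by rw [hx]; push_cast; ring)
  have hDA : 0 < x ^ 4 * (x ^ 2 - 1) := mul_pos (pow_pos hx0 4) hx21
  have hDB : 0 < 2 * (x + 2) ^ 6 * ((x + 2) ^ 2 - 1) := mul_pos (mul_pos two_pos (pow_pos (by linarith) 6)) (by nlinarith)
  have e : (64 - 48 * (x + 2) + 41 * (x + 2) ^ 2 - 28 * (x + 2) ^ 3 + 10 * (x + 2) ^ 4 - 20 * (x + 2) ^ 5 + 7 * (x + 2) ^ 6 - 4 * (x + 2) ^ 7 + 2 * (x + 2) ^ 8) * (x ^ 4 * (x ^ 2 - 1))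
      - (9 - 12 * x + 10 * x ^ 2 - 4 * x ^ 3 + 4 * x ^ 4 - 2 * x ^ 5 + x ^ 6) * (2 * (x + 2) ^ 6 * ((x + 2) ^ 2 - 1))
      = -3456 - 10368 * x - 11808 * x ^ 2 - 7232 * x ^ 3 - 5708 * x ^ 4 - 8620 * x ^ 5 - 10363 * x ^ 6 - 7992 * x ^ 7 - 3683 * x ^ 8 - 828 * x ^ 9 + 19 * x ^ 10 + 48 * x ^ 11 + 7 * x ^ 12 := by ring
  have hP := chainPoly_pos hx5
  have hlt : (9 - 12 * x + 10 * x ^ 2 - 4 * x ^ 3 + 4 * x ^ 4 - 2 * x ^ 5 + x ^ 6) / (x ^ 4 * (x ^ 2 - 1))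
      < (64 - 48 * (x + 2) + 41 * (x + 2) ^ 2 - 28 * (x + 2) ^ 3 + 10 * (x + 2) ^ 4 - 20 * (x + 2) ^ 5 + 7 * (x + 2) ^ 6 - 4 * (x + 2) ^ 7 + 2 * (x + 2) ^ 8) / (2 * (x + 2) ^ 6 * ((x + 2) ^ 2 - 1)) := by
    rw [div_lt_div_iff₀ hDA hDB]
    linarith
  exact lt_of_le_of_lt hA (lt_of_lt_of_le hlt hB)

/-- `R_4` is strictly increasing on `d ≥ 2`. [folklore] -/
theorem loopCompat_four_lt_of_lt {d e : ℕ} (hd : 2 ≤ d) (hde : d < e) : loopCompat d 4 < loopCompat e 4 := by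
  induction e with
  | zero => omega
  | succ e ih =>
    rcases Nat.lt_succ_iff_lt_or_eq.1 hde with h | h
    · exact (ih h).trans (loopCompat_four_lt_succ (by omega))
    · subst h; exact loopCompat_four_lt_succ hd

/-- **The `m = 2` instance of the typed conjecture `loopCompatStrictMonoDim` (clause (b) of C4) is a theorem**:
`R_4(d) < R_4(d+1)` for every `d ≥ 2`. [folklore] -/
theorem loopCompatStrictMonoDim_rung_four (d : ℕ) (hd : 2 ≤ d) : loopCompat d (2 * 2) < loopCompat (d + 1) (2 * 2) :=
  loopCompat_four_lt_succ hd

end Summit.CriticalPhenomena.PercolationContinuityZ3.Theorems.Pcint.MemoryTail
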